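import Mathlib
import Summits.KontsevichZagierPeriods.KontsevichZagierPeriods.Theses.FurushoPentagon
import Summits.KontsevichZagierPeriods.KontsevichZagierPeriods.Theses.OctahedralSymmetry
import Summits.KontsevichZagierPeriods.KontsevichZagierPeriods.Theses.Deregularisation

/-!
# Sketch — crux HoffmanRelationInKZ (stmt-KontsevichZagierPeriods-3930), idea `level-two-descent`

Level-2 letters on `(0,1)`: `a = dt/t` (index 0), `b = dt/(1-t)` (index 1), `c = dt/(1+t)` (index 2);
`I(w) = ∫_{1>t₀>⋯>t_{n-1}>0} ∏ letter (w i) (t i)`, outer letter first. All statements below are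
memberships in `KZ.relations` of ℤ-combinations of RATIONAL simplex representations.
-/

namespace Summit.KontsevichZagierPeriods.KontsevichZagierPeriods.Cruxes.HoffmanRelationInKZ.LevelTwoDescent

open Literature.NumberTheory.Transcendental

/-- The three level-2 letters `ω_a = 1/t`, `ω_b = 1/(1-t)`, `ω_c = 1/(1+t)`. -/
noncomputable def l2Form : Fin 3 → ℝ → ℝ :=
  ![fun t => 1 / t, fun t => 1 / (1 - t), fun t => 1 / (1 + t)]

/-- A family of weight-3 level-2 word representations on the ordered simplex `Δ₃`
(only the words actually used are constrained through `w.length = 3`). -/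
def IsLevelTwoFamily3 (R : List (Fin 3) → KZ.IntegralRep 3) : Prop :=
  (∀ w, (R w).domain = {t | 1 > t 0 ∧ t 0 > t 1 ∧ t 1 > t 2 ∧ t 2 > 0}) ∧
  (∀ w, w.length = 3 → Set.EqOn (R w).integrand
      (fun t => l2Form (w.getD 0 0) (t 0) * l2Form (w.getD 1 0) (t 1) * l2Form (w.getD 2 0) (t 2))
      (R w).domain)

/-- Same in weight 4 on `Δ₄` (domain literal of `Deregularisation.HoffmanWeightFour`). -/
def IsLevelTwoFamily4 (R : List (Fin 3) → KZ.IntegralRep 4) : Prop :=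
  (∀ w, (R w).domain = {t | 1 > t 0 ∧ t 0 > t 1 ∧ t 1 > t 2 ∧ t 2 > t 3 ∧ t 3 > 0}) ∧
  (∀ w, w.length = 4 → Set.EqOn (R w).integrand
      (fun t => l2Form (w.getD 0 0) (t 0) * l2Form (w.getD 1 0) (t 1) *
        l2Form (w.getD 2 0) (t 2) * l2Form (w.getD 3 0) (t 3))
      (R w).domain)

/-- FIRST LEMMA (weight 3, the smallest new engine block): the finite double shuffle of the
CONVERGENT weight-one period `log 2 = I(c)` with `ζ(2) = I(ab)`, linearised (shuffle side minus
stuffle side; the product representation `[c]·[ab]` is the common intermediate):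
`I(cab) + I(acb) + I(cac) − I(aac) = 0` as a KZ relation among four rational simplex reps.
Numerically checked to 2e−30 (numerics/level2span.py). -/
def LogTwoZetaTwoDoubleShuffle : Prop :=
  ∀ R : List (Fin 3) → KZ.IntegralRep 3, IsLevelTwoFamily3 R →
    KZ.of (R [2, 0, 1]) + KZ.of (R [0, 2, 1]) + KZ.of (R [2, 0, 2]) - KZ.of (R [0, 0, 2])
      ∈ KZ.relations

/-! ### The weight-4 certificate: eight regularisation-free level-2 relations -/

/-- D1 = DS(c, aab): `[aacb] + [acab] + [caab] − [aaac] + [caac]`. -/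
def D1 (R : List (Fin 3) → KZ.IntegralRep 4) : Prop :=
  KZ.of (R [0,0,2,1]) + KZ.of (R [0,2,0,1]) + KZ.of (R [2,0,0,1]) - KZ.of (R [0,0,0,2])
    + KZ.of (R [2,0,0,2]) ∈ KZ.relations
/-- D2 = DS(c, aac): `2[aacc] + [acac] + [caac] − [aaab] + [aacb] + [caab]`. -/
def D2 (R : List (Fin 3) → KZ.IntegralRep 4) : Prop :=
  2 • KZ.of (R [0,0,2,2]) + KZ.of (R [0,2,0,2]) + KZ.of (R [2,0,0,2]) - KZ.of (R [0,0,0,1])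
    + KZ.of (R [0,0,2,1]) + KZ.of (R [2,0,0,1]) ∈ KZ.relations
/-- D3 = DS(ab, ab): `4[aabb] − [aaab]` (ζ(2)²: shuffle 4ζ(3,1)+2ζ(2,2), stuffle 2ζ(2,2)+ζ(4)). -/
def D3 (R : List (Fin 3) → KZ.IntegralRep 4) : Prop :=
  4 • KZ.of (R [0,0,1,1]) - KZ.of (R [0,0,0,1]) ∈ KZ.relations
/-- D4 = DS(ab, ac): `2[aabc] + 2[aacb] + [acab] − [aaac] + [acac]`. -/
def D4 (R : List (Fin 3) → KZ.IntegralRep 4) : Prop :=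
  2 • KZ.of (R [0,0,1,2]) + 2 • KZ.of (R [0,0,2,1]) + KZ.of (R [0,2,0,1]) - KZ.of (R [0,0,0,2])
    + KZ.of (R [0,2,0,2]) ∈ KZ.relations
/-- D5 = DS(ac, ac): `4[aacc] + 2[acac] + 2[acab] − [aaab]`. -/
def D5 (R : List (Fin 3) → KZ.IntegralRep 4) : Prop :=
  4 • KZ.of (R [0,0,2,2]) + 2 • KZ.of (R [0,2,0,2]) + 2 • KZ.of (R [0,2,0,1]) - KZ.of (R [0,0,0,1])
    ∈ KZ.relations
/-- S1 = squaring t ↦ t² of ζ(4): `8[aaac] − 7[aaab]` (alternating ζ(4) = 7/8 ζ(4)). -/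
def S1 (R : List (Fin 3) → KZ.IntegralRep 4) : Prop :=
  8 • KZ.of (R [0,0,0,2]) - 7 • KZ.of (R [0,0,0,1]) ∈ KZ.relations
/-- S2 = squaring of ζ(2,2): `4[abac] + 4[acab] − 4[acac] − 3[abab]`. -/
def S2 (R : List (Fin 3) → KZ.IntegralRep 4) : Prop :=
  4 • KZ.of (R [0,1,0,2]) + 4 • KZ.of (R [0,2,0,1]) - 4 • KZ.of (R [0,2,0,2]) - 3 • KZ.of (R [0,1,0,1])
    ∈ KZ.relations
/-- L1 = lift `[ab] · (squaring of ζ(2))`, expanded by shuffles: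
`4[aabc] + 4[aacb] + 2[abac] + 2[acab] − 2[abab] − 4[aabb]`. -/
def L1 (R : List (Fin 3) → KZ.IntegralRep 4) : Prop :=
  4 • KZ.of (R [0,0,1,2]) + 4 • KZ.of (R [0,0,2,1]) + 2 • KZ.of (R [0,1,0,2]) + 2 • KZ.of (R [0,2,0,1])
    - 2 • KZ.of (R [0,1,0,1]) - 4 • KZ.of (R [0,0,1,1]) ∈ KZ.relations

/-- CERTIFICATE (pure bookkeeping in the free abelian group + IntegerDivision by 4):
`8·D1 − 8·D2 + 7·D3 − 16·D4 + 4·D5 − S1 − 4·S2 + 8·L1 = 4·([aaab] − [aabb] − [abab])`, hence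
Hoffman's weight-4 relation ζ(4) = ζ(3,1) + ζ(2,2) for the family `R` — no ζ(1), no regularisation,
no limit: every generator is a finite chain of moves on absolutely convergent rational integrals. -/
def HoffmanWeightFourViaLevelTwo : Prop :=
  ∀ R : List (Fin 3) → KZ.IntegralRep 4, IsLevelTwoFamily4 R →
    D1 R → D2 R → D3 R → D4 R → D5 R → S1 R → S2 R → L1 R →
    Summit.KontsevichZagierPeriods.KontsevichZagierPeriods.Theses.FurushoPentagon.IntegerDivision →
    KZ.of (R [0,0,0,1]) - KZ.of (R [0,0,1,1]) - KZ.of (R [0,1,0,1]) ∈ KZ.relations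

/-- The certificate arithmetic itself, checked: in any additive commutative group. -/
theorem certificate_identity {G : Type} [AddCommGroup G] (aaab aabb abab aaac aabc aacb abac
    acab acac aacc caab caac : G) :
    8 • ((aacb + acab + caab - aaac + caac))
    - 8 • ((2 • aacc + acac + caac - aaab + aacb + caab))
    + 7 • ((4 • aabb - aaab))
    - 16 • ((2 • aabc + 2 • aacb + acab - aaac + acac))
    + 4 • ((4 • aacc + 2 • acac + 2 • acab - aaab))
    - (8 • aaac - 7 • aaab)
    - 4 • ((4 • abac + 4 • acab - 4 • acac - 3 • abab))
    + 8 • ((4 • aabc + 4 • aacb + 2 • abac + 2 • acab - 2 • abab - 4 • aabb))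
    = 4 • (aaab - aabb - abab) := by
  abel

/-- The engines this line leans on, by name (existing route decls, generic in the integrand):
squaring = `SimplexDilationMove`, involution t ↦ (1−t)/(1+t) = `OctahedralInvolutionMove`,
division = `IntegerDivision`; the weight-4 target it closes = `Deregularisation.HoffmanWeightFour`;
the crux = `FurushoPentagon.HoffmanRelationInKZ`. -/
def EnginesNamed : Prop :=
  Summit.KontsevichZagierPeriods.KontsevichZagierPeriods.Theses.OctahedralSymmetry.SimplexDilationMove ∧
  Summit.KontsevichZagierPeriods.KontsevichZagierPeriods.Theses.OctahedralSymmetry.OctahedralInvolutionMove ∧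
  Summit.KontsevichZagierPeriods.KontsevichZagierPeriods.Theses.FurushoPentagon.IntegerDivision ∧
  (Summit.KontsevichZagierPeriods.KontsevichZagierPeriods.Theses.Deregularisation.HoffmanWeightFour →
    True) ∧
  (Summit.KontsevichZagierPeriods.KontsevichZagierPeriods.Theses.FurushoPentagon.HoffmanRelationInKZ → True)

end Summit.KontsevichZagierPeriods.KontsevichZagierPeriods.Cruxes.HoffmanRelationInKZ.LevelTwoDescent
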